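import Mathlib.Analysis.Distribution.TemperedDistribution
import Mathlib.Analysis.LocallyConvex.Barrelled
import Literature.Analysis.FunctionSpaces.SchwartzComplete
import Literature.Analysis.FunctionSpaces.NuclearSpaceSchwartzSeparableProofs
import Literature.Analysis.FunctionSpaces.DiagonalWeakLimits
import HarnessLib

/-!
# Weak-* sequential compactness of bounded sequences of tempered distributions

Analysis/FunctionSpaces support file (theorems only, fully proved). For a finite-dimensional real
normed space `E` and a finite-dimensional complex normed space `F`, every sequence of tempered
distributions `u_n ∈ 𝓢'(E, F)` (Mathlib: `𝓢(E, ℂ) →Lₚₜ[ℂ] F`, continuous linear maps with the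
topology of pointwise = weak-* convergence) which is **weak-* bounded** — `sup_n ‖⟨u_n, θ⟩‖ < ∞` for
every test function `θ` — has a subsequence converging in `𝓢'(E, F)`:

* `TemperedDistribution.exists_seminorm_bound_of_forall_bddAbove` — **uniform boundedness**: a
  weak-* bounded family is equicontinuous, i.e. `‖⟨u_i, θ⟩‖ ≤ C · max_{(k,n) ∈ s} p_{k,n}(θ)` for a
  finite set `s` of Schwartz seminorms and one constant `C`, uniformly in `i` (Banach–Steinhaus on
  the barrelled space `𝓢(E, ℂ)`: Mathlib's `WithSeminorms.banach_steinhaus` with the tree's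
  `barrelledSpace_schwartzMap`, `SchwartzComplete.lean`);
* `TemperedDistribution.exists_strictMono_tendsto_of_seminorm_bound` — an equicontinuous sequence
  has a weak-* convergent subsequence, whose limit obeys the same bound (Cantor's diagonal
  procedure on a countable dense subset of `𝓢(E, ℂ)` — the tree's
  `exists_strictMono_forall_tendsto` (`DiagonalWeakLimits.lean`) and
  `separableSpace_schwartzMap_holds` (`NuclearSpaceSchwartzSeparableProofs.lean`) — then
  convergence at every test function by an `ε/3` argument, and continuity of the limit functional by
  Banach–Steinhaus again, Mathlib's `continuousLinearMapOfTendsto`);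
* `TemperedDistribution.exists_strictMono_tendsto_of_forall_bddAbove` — the two combined: **every
  weak-* bounded sequence in `𝓢'(E, F)` has a weak-* convergent subsequence** (sequential
  Banach–Alaoglu for `𝓢'`; equivalently: bounded subsets of `𝓢'` are relatively sequentially
  compact, `𝓢` being a separable Fréchet–Montel space);
* `TemperedDistribution.norm_apply_le_of_tendsto` — bounds `‖⟨u_n, θ⟩‖ ≤ b` pass to weak-* limits.

This is the extraction step behind every "let `φ` be a weak limit point of the bounded sequence
`(f_n)`" in the profile-decomposition literature (Gallagher–Koch–Planchon 2016, Thm. 2 and §2.4: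
"`φ_{j₀}` is the weak limit of `u_{0,n}`"; Bahouri–Chemin–Danchin 2011, Thm. 2.25, the Fatou
property of Besov spaces, whose first half is the `𝓢'`-convergence of a subsequence), used there
for sequences bounded in a homogeneous Besov space — such sequences are weak-* bounded by the
embedding `Ḃ^{-σ}_{p,∞} ∩ 𝓢'_h ↪ 𝓢'` (`BesovPairing.lean`).

## References

* W. Rudin, *Functional Analysis*, 2nd ed. (1991), Thm. 2.6 (Banach–Steinhaus on barrelled /
  F-spaces), Thm. 2.8 (limits of pointwise convergent sequences of continuous linear maps),
  Thm. 7.4 (a) (`𝒮ₙ` is a Fréchet space). [cite: Rudin1991, Thm 2.6]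
* F. Trèves, *Topological Vector Spaces, Distributions and Kernels* (1967), Prop. 34.4
  (`𝒮(𝐑ⁿ)` is a Montel space), Prop. 34.6 with Cor. 2 (closed bounded subsets of the strong dual
  of a Montel space are compact, and on them strong and weak topologies coincide; in `𝒮'` every
  weakly convergent sequence is strongly convergent), Thm. 33.2 (Banach–Steinhaus for duals), and
  Appendix p. 556 (`𝒮` is separable). [cite: Treves1967, Prop. 34.4 and Prop. 34.6]
* I. Gallagher, G. S. Koch, F. Planchon, Comm. Math. Phys. 343 (2016) = arXiv:1407.4156, Thm. 2
  ("let `φ₁` be any weak limit point of `(f_n)`") and §2.4. [cite: GKP2016, §2.4]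
-/

noncomputable section

open Filter Set Function TopologicalSpace
open _root_.Topology
open scoped SchwartzMap NNReal

namespace Literature.Analysis.FunctionSpaces

namespace TemperedDistribution

variable {E F : Type*} [NormedAddCommGroup E] [NormedSpace ℝ E]
  [NormedAddCommGroup F] [NormedSpace ℂ F]

/-! ### Banach–Steinhaus: weak-* bounded families of tempered distributions are equicontinuous -/

/-- **Uniform boundedness for tempered distributions.** If a family `u i ∈ 𝓢'(E, F)` is weak-*
bounded — for every test function `θ` the set `{‖⟨u i, θ⟩‖}_i` is bounded above — then there are a
finite set `s` of Schwartz seminorm indices and a constant `C` with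
`‖⟨u i, θ⟩‖ ≤ C · (s.sup p)(θ)` for all `i` and `θ` (Banach–Steinhaus on the barrelled space
`𝓢(E, ℂ)`; Rudin, *Functional Analysis*, Thm. 2.6 with Thm. 7.4 (a)). [cite: Rudin1991, Thm 2.6] -/
theorem exists_seminorm_bound_of_forall_bddAbove {ι : Type*} (u : ι → 𝓢'(E, F))
    (hb : ∀ θ : 𝓢(E, ℂ), BddAbove (range fun i => ‖u i θ‖)) :
    ∃ (s : Finset (ℕ × ℕ)) (C : ℝ≥0), ∀ i θ,
      ‖u i θ‖ ≤ C * (s.sup (schwartzSeminormFamily ℂ E ℂ)) θ := by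
  haveI : BarrelledSpace ℂ 𝓢(E, ℂ) := barrelledSpace_schwartzMap
  -- the family as honest continuous linear maps `𝓢(E, ℂ) →L[ℂ] F`
  let 𝓕 : ι → 𝓢(E, ℂ) →L[ℂ] F := fun i =>
    (UniformConvergenceCLM.ofFun (RingHom.id ℂ) F {S : Set 𝓢(E, ℂ) | Finite S}).symm (u i)
  have h𝓕 : ∀ i θ, 𝓕 i θ = u i θ := fun _ _ => rfl
  -- Banach–Steinhaus: pointwise boundedness gives uniform equicontinuity
  have hq := norm_withSeminorms ℂ F
  have hequi : UniformEquicontinuous ((↑) ∘ 𝓕) := by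
    refine hq.banach_steinhaus fun _ θ => ?_
    simpa only [coe_normSeminorm, h𝓕] using hb θ
  -- equicontinuity = domination by one continuous seminorm, itself dominated by finitely many
  -- Schwartz seminorms
  obtain ⟨q, hqc, hqle⟩ :=
    ((hq.uniformEquicontinuous_iff_exists_continuous_seminorm
      (fun i => (𝓕 i).toLinearMap)).1 hequi) 0
  obtain ⟨s, C, -, hC⟩ := Seminorm.bound_of_continuous (schwartz_withSeminorms ℂ E ℂ) q hqc
  refine ⟨s, C, fun i θ => ?_⟩
  calc ‖u i θ‖ = ((normSeminorm ℂ F).comp (𝓕 i).toLinearMap) θ := by simp [h𝓕]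
    _ ≤ q θ := hqle i θ
    _ ≤ (C • s.sup (schwartzSeminormFamily ℂ E ℂ)) θ := hC θ
    _ = C * (s.sup (schwartzSeminormFamily ℂ E ℂ)) θ := rfl

/-- A weak-* bounded *sequence* `u n ∈ 𝓢'(E, F)` (`‖⟨u n, θ⟩‖ ≤ M θ` for all `n`) is
equicontinuous: `‖⟨u n, θ⟩‖ ≤ C · (s.sup p)(θ)` for finitely many Schwartz seminorms (the
sequence form of `exists_seminorm_bound_of_forall_bddAbove`). [cite: Rudin1991, Thm 2.6] -/
theorem exists_seminorm_bound_of_forall_exists_le (u : ℕ → 𝓢'(E, F))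
    (hb : ∀ θ : 𝓢(E, ℂ), ∃ M : ℝ, ∀ n, ‖u n θ‖ ≤ M) :
    ∃ (s : Finset (ℕ × ℕ)) (C : ℝ≥0), ∀ n θ,
      ‖u n θ‖ ≤ C * (s.sup (schwartzSeminormFamily ℂ E ℂ)) θ :=
  exists_seminorm_bound_of_forall_bddAbove u fun θ => by
    obtain ⟨M, hM⟩ := hb θ
    exact ⟨M, by rintro _ ⟨n, rfl⟩; exact hM n⟩

/-! ### Bounds pass to weak-* limits -/

/-- **Bounds pass to weak-* limits**: if `u i → v` in `𝓢'(E, F)` along a nontrivial filter and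
eventually `‖⟨u i, θ⟩‖ ≤ b`, then `‖⟨v, θ⟩‖ ≤ b` (the pairing with `θ` is continuous for the
weak-* topology). [folklore] -/
theorem norm_apply_le_of_tendsto {ι : Type*} {l : Filter ι} [l.NeBot] {u : ι → 𝓢'(E, F)}
    {v : 𝓢'(E, F)} (h : Tendsto u l (𝓝 v)) (θ : 𝓢(E, ℂ)) {b : ℝ}
    (hb : ∀ᶠ i in l, ‖u i θ‖ ≤ b) : ‖v θ‖ ≤ b :=
  le_of_tendsto ((PointwiseConvergenceCLM.tendsto_iff_forall_tendsto.1 h θ).norm) hb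

/-! ### Diagonal extraction: equicontinuous sequences have weak-* convergent subsequences -/

variable [FiniteDimensional ℝ E] [ProperSpace F]

/-- **An equicontinuous sequence of tempered distributions has a weak-* convergent subsequence.**
Let `F` be a finite-dimensional (proper) complex normed space and `u n ∈ 𝓢'(E, F)` satisfy
`‖⟨u n, θ⟩‖ ≤ C · (s.sup p)(θ)` for all `n`, `θ`, with `s` a finite set of Schwartz seminorms.
Then some subsequence `u (φ n)` converges in `𝓢'(E, F)` (i.e. `⟨u (φ n), θ⟩ → ⟨v, θ⟩` for every
`θ`) to a tempered distribution `v` obeying the same bound. Proof: on a countable dense subset `D`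
of `𝓢(E, ℂ)` (`separableSpace_schwartzMap_holds`) the values stay in fixed compact balls of `F`,
so Cantor's diagonal procedure (`exists_strictMono_forall_tendsto`) gives a subsequence converging
on `D`; by the uniform bound the subsequence is Cauchy, hence convergent, at every `θ` (`ε/3`
through a point of `D` in the `(s.sup p)`-ball of radius `ε/(3(C+1))` about `θ`); the pointwise
limit of continuous linear maps on the barrelled space `𝓢(E, ℂ)` is continuous (Banach–Steinhaus,
Mathlib's `continuousLinearMapOfTendsto`; Rudin, Thm. 2.8). [cite: Rudin1991, Thm 2.6] -/
theorem exists_strictMono_tendsto_of_seminorm_bound (u : ℕ → 𝓢'(E, F)) (s : Finset (ℕ × ℕ))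
    (C : ℝ≥0) (hb : ∀ n θ, ‖u n θ‖ ≤ C * (s.sup (schwartzSeminormFamily ℂ E ℂ)) θ) :
    ∃ (v : 𝓢'(E, F)) (φ : ℕ → ℕ), StrictMono φ ∧ Tendsto (fun n => u (φ n)) atTop (𝓝 v) ∧
      ∀ θ, ‖v θ‖ ≤ C * (s.sup (schwartzSeminormFamily ℂ E ℂ)) θ := by
  haveI : BarrelledSpace ℂ 𝓢(E, ℂ) := barrelledSpace_schwartzMap
  haveI : SeparableSpace 𝓢(E, ℂ) := separableSpace_schwartzMap_holds E ℂ
  set q : Seminorm ℂ 𝓢(E, ℂ) := s.sup (schwartzSeminormFamily ℂ E ℂ) with hq_def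
  -- a countable dense set of test functions
  obtain ⟨D, hDc, hDd⟩ := exists_countable_dense 𝓢(E, ℂ)
  haveI : Countable D := hDc.to_subtype
  -- Step 1: diagonal extraction on `D` (values in the compact balls `B̄(0, C q d)`)
  obtain ⟨φ, hφ, hconvD⟩ := exists_strictMono_forall_tendsto (fun n (d : D) => u n (d : 𝓢(E, ℂ)))
    fun d => ⟨0, C * q d, fun n => by
      simpa only [Metric.mem_closedBall, dist_zero_right] using hb n d⟩
  -- Step 2: the subsequence converges at every test function (Cauchy by `ε/3`)
  have hconv : ∀ θ : 𝓢(E, ℂ), ∃ l : F, Tendsto (fun n => u (φ n) θ) atTop (𝓝 l) := by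
    intro θ
    refine cauchySeq_tendsto_of_complete (Metric.cauchySeq_iff.2 fun ε hε => ?_)
    -- a point `d ∈ D` with `C * q (d - θ) < ε / 3`
    have hδ : 0 < ε / (3 * ((C : ℝ) + 1)) := by positivity
    have hball : q.ball θ (ε / (3 * ((C : ℝ) + 1))) ∈ 𝓝 θ :=
      ((schwartz_withSeminorms ℂ E ℂ).mem_nhds_iff θ _).2 ⟨s, _, hδ, subset_rfl⟩
    obtain ⟨d, hdB, hdD⟩ := mem_closure_iff_nhds.1 (hDd θ) _ hball
    rw [Seminorm.mem_ball] at hdB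
    have hnear : ∀ n, dist (u n θ) (u n d) < ε / 3 := fun n => by
      rw [dist_eq_norm, ← map_sub]
      calc ‖u n (θ - d)‖ ≤ C * q (θ - d) := hb n _
        _ = C * q (d - θ) := by rw [map_sub_rev]
        _ ≤ ((C : ℝ) + 1) * q (d - θ) := by
            gcongr
            exact le_add_of_nonneg_right zero_le_one
        _ < ((C : ℝ) + 1) * (ε / (3 * ((C : ℝ) + 1))) := by gcongr
        _ = ε / 3 := by field_simp
    obtain ⟨l, hl⟩ := hconvD ⟨d, hdD⟩
    obtain ⟨N, hN⟩ := Metric.cauchySeq_iff.1 hl.cauchySeq (ε / 3) (by positivity)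
    refine ⟨N, fun m hm n hn => ?_⟩
    calc dist (u (φ m) θ) (u (φ n) θ)
        ≤ dist (u (φ m) θ) (u (φ m) d) + dist (u (φ m) d) (u (φ n) d) +
            dist (u (φ n) d) (u (φ n) θ) := dist_triangle4 _ _ _ _
      _ < ε / 3 + ε / 3 + ε / 3 := by
          refine add_lt_add (add_lt_add (hnear _) (hN m hm n hn)) ?_
          rw [dist_comm]
          exact hnear _
      _ = ε := by ring
  choose f hf using hconv
  -- Step 3: the pointwise limit is a continuous linear map (Banach–Steinhaus)
  let 𝓕 : ℕ → 𝓢(E, ℂ) →L[ℂ] F := fun n =>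
    (UniformConvergenceCLM.ofFun (RingHom.id ℂ) F {S : Set 𝓢(E, ℂ) | Finite S}).symm (u (φ n))
  have h𝓕 : ∀ n θ, 𝓕 n θ = u (φ n) θ := fun _ _ => rfl
  have hlim : Tendsto (fun n θ => 𝓕 n θ) atTop (𝓝 f) :=
    tendsto_pi_nhds.2 fun θ => by simpa only [h𝓕] using hf θ
  let v₀ : 𝓢(E, ℂ) →L[ℂ] F := continuousLinearMapOfTendsto 𝓕 hlim
  have hv₀ : ∀ θ, v₀ θ = f θ := fun _ => rfl
  let v : 𝓢'(E, F) := ContinuousLinearMap.toPointwiseConvergenceCLM ℂ (RingHom.id ℂ) 𝓢(E, ℂ) F v₀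
  have hv : ∀ θ, v θ = f θ := fun _ => rfl
  refine ⟨v, φ, hφ, ?_, fun θ => ?_⟩
  · refine PointwiseConvergenceCLM.tendsto_iff_forall_tendsto.2 fun θ => ?_
    rw [hv]
    exact hf θ
  · rw [hv]
    exact le_of_tendsto (hf θ).norm (Eventually.of_forall fun n => hb (φ n) θ)

/-- **Sequential Banach–Alaoglu for `𝓢'`: every weak-* bounded sequence of tempered
distributions has a weak-* convergent subsequence.** For `u n ∈ 𝓢'(E, F)`, `F` finite-dimensional,
with `sup_n ‖⟨u n, θ⟩‖ < ∞` for every `θ ∈ 𝓢(E, ℂ)`, there are a tempered distribution `v` and a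
subsequence `u (φ n) → v` in `𝓢'(E, F)`, i.e. `⟨u (φ n), θ⟩ → ⟨v, θ⟩` for every test function `θ`
(`exists_seminorm_bound_of_forall_exists_le` + `exists_strictMono_tendsto_of_seminorm_bound`). This
is the extraction "let `φ₁` be any weak limit point of the bounded sequence `(f_n)`" of
Gallagher–Koch–Planchon 2016, Thm. 2 and §2.4, for sequences bounded in `𝓢'`.
[cite: GKP2016, §2.4] -/
theorem exists_strictMono_tendsto_of_forall_bddAbove (u : ℕ → 𝓢'(E, F))
    (hb : ∀ θ : 𝓢(E, ℂ), ∃ M : ℝ, ∀ n, ‖u n θ‖ ≤ M) :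
    ∃ (v : 𝓢'(E, F)) (φ : ℕ → ℕ), StrictMono φ ∧ Tendsto (fun n => u (φ n)) atTop (𝓝 v) := by
  obtain ⟨s, C, hC⟩ := exists_seminorm_bound_of_forall_exists_le u hb
  obtain ⟨v, φ, hφ, hv, -⟩ := exists_strictMono_tendsto_of_seminorm_bound u s C hC
  exact ⟨v, φ, hφ, hv⟩

/-- **Weak-* limit points along subsequences of subsequences**: under the hypotheses of
`exists_strictMono_tendsto_of_forall_bddAbove`, every subsequence `u ∘ ψ` again has a weak-*
convergent subsequence (boundedness is inherited); the form in which the extraction is iterated in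
profile decompositions. [cite: GKP2016, §2.4] -/
theorem exists_strictMono_tendsto_comp_of_forall_bddAbove (u : ℕ → 𝓢'(E, F))
    (hb : ∀ θ : 𝓢(E, ℂ), ∃ M : ℝ, ∀ n, ‖u n θ‖ ≤ M) {ψ : ℕ → ℕ} (hψ : StrictMono ψ) :
    ∃ (v : 𝓢'(E, F)) (φ : ℕ → ℕ), StrictMono φ ∧ StrictMono (ψ ∘ φ) ∧
      Tendsto (fun n => u (ψ (φ n))) atTop (𝓝 v) := by
  obtain ⟨v, φ, hφ, hv⟩ := exists_strictMono_tendsto_of_forall_bddAbove (u ∘ ψ)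
    fun θ => (hb θ).imp fun M hM n => hM (ψ n)
  exact ⟨v, φ, hφ, hψ.comp hφ, hv⟩

end TemperedDistribution

end Literature.Analysis.FunctionSpaces
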